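import Summits.QuantumAdvantage.QuantumAdvantage.Theorems.WbwVerifiableLineNoSpeedup.Negative.WeightedAdversary
import Literature.Computability.QuantumComplexity.ExactQuantumQuery

/-!
# Ambainis's weighted relational adversary method for `QQueryAlg`, II: the bound `√(m m'/l_max) ≤ 144 Q_{1/3}`

Sequel to `WeightedAdversary.lean` (same provenance: support for the crux
`WhiteBoxWalk.WbwVerifiableLineNoSpeedup`, stmt-QuantumAdvantage-2239, work file `Disproof.lean` §7).
The fold over the queries (`card_le_queries_mul`: `|R|/72 ≤ T √ℓ (λ|X| + |Y|/λ)` for every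
`λ > 0`), fibre counting (`m₀ |X| ≤ |R|`, `m₁ |Y| ≤ |R|`), the choice `λ = √(m₀/m₁)`, and the three
packagings: `sqrt_le_queries` (for an algorithm), `sqrt_le_quantumQueryComplexityOn` (for
`Q_{1/3}` on a promise set) and `weightedAdversaryBound_holds` — verbatim the target
`WeightedAdversaryBound` of the crux work file with `κ = 1/144` [Ambainis2000, Thm. 6].
Sorry-free.
-/

noncomputable section

set_option linter.dupNamespace false

namespace Summit.QuantumAdvantage.QuantumAdvantage.Theorems.WbwVerifiableLineNoSpeedup.Negative.WeightedAdversary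

open Matrix Finset Literature.Computability.Cryptography Literature.Computability.QuantumComplexity
  Literature.Computability.QuantumComplexity.SpectralAdversary

variable {N : ℕ}

/-! ### The weighted adversary bound -/

/-- **Ambainis's weighted relational adversary bound (Thm 6), parametric form**: if `A` computes
`f` with error `1/3` on `D` and `R ⊆ D × D` relates inputs with different values, then for every
`λ > 0`, `|R|/72 ≤ T · √ℓ · (λ |R.fst| + |R.snd| / λ)`, `ℓ` any bound on the products
`ℓ_{x,i} ℓ_{y,i}` over related pairs differing at `i`. [cite: Ambainis2000, Thm. 6] -/
theorem card_le_queries_mul (A : QQueryAlg N) {D : Set (Fin N → Bool)} {f : (Fin N → Bool) → Bool}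
    (hA : A.ComputesWithError (1 / 3) D f) (R : Rel N)
    (hD : ∀ e ∈ R, e.1 ∈ D ∧ e.2 ∈ D) (hf : ∀ e ∈ R, f e.1 ≠ f e.2)
    {ℓ lam : ℝ} (hℓ : 0 < ℓ) (hlam : 0 < lam)
    (hR : ∀ e ∈ R, ∀ i, e.1 i ≠ e.2 i → (l1 R e.1 i : ℝ) * l2 R e.2 i ≤ ℓ) :
    (#R : ℝ) / 72 ≤ A.queries * (Real.sqrt ℓ * (lam * #(R.image Prod.fst) + #(R.image Prod.snd) / lam)) := by
  classical
  set B : ℝ := Real.sqrt ℓ * (lam * #(R.image Prod.fst) + #(R.image Prod.snd) / lam) with hB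
  let v : Fin N × Bool × A.W → ℂ := (A.unitaries 0).1 *ᵥ Pi.single A.start 1
  let Ψ₀ : (Fin N → Bool) → Fin N × Bool × A.W → ℂ := fun _ => v
  let F : ((Fin N → Bool) → Fin N × Bool × A.W → ℂ) → Fin A.queries →
      ((Fin N → Bool) → Fin N × Bool × A.W → ℂ) :=
    fun Ψ j b => (A.unitaries j.succ).1 *ᵥ (queryOracle b *ᵥ Ψ b)
  have hfin : (fun x => A.finalState x) = Fin.foldl A.queries F Ψ₀ :=
    foldl_pi A.queries (fun (x : Fin N → Bool) (ψ : Fin N × Bool × A.W → ℂ)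
      (j : Fin A.queries) => (A.unitaries j.succ).1 *ᵥ (queryOracle x *ᵥ ψ)) Ψ₀
  have hv : nsq v = 1 := by
    show nsq ((A.unitaries 0).1 *ᵥ Pi.single A.start (1 : ℂ)) = 1
    rw [nsq_mulVec_of_mem_unitaryGroup (A.unitaries 0).2]
    unfold nsq
    rw [Finset.sum_eq_single A.start]
    · simp
    · intro s _ hs; simp [hs]
    · simp
  have key : prog R Ψ₀ - prog R (Fin.foldl A.queries F Ψ₀) ≤ (A.queries : ℝ) * B ∧
      ∀ x, nsq (Fin.foldl A.queries F Ψ₀ x) = 1 := by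
    refine foldl_invariant A.queries F Ψ₀
      (fun j Ψ => prog R Ψ₀ - prog R Ψ ≤ (j : ℝ) * B ∧ ∀ x, nsq (Ψ x) = 1) ?_ ?_
    · exact ⟨by simp, fun _ => hv⟩
    · rintro j Ψ ⟨hW, hunit⟩
      refine ⟨?_, fun x => ?_⟩
      · have hstep := prog_sub_prog_step_le R hℓ hlam hR (A.unitaries j.succ).2 Ψ hunit
        change prog R Ψ₀ -
            prog R (fun b => (A.unitaries j.succ).1 *ᵥ (queryOracle b *ᵥ Ψ b)) ≤
          (((j : ℕ) + 1 : ℕ) : ℝ) * B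
        push_cast
        rw [← hB] at hstep
        linarith
      · change nsq ((A.unitaries j.succ).1 *ᵥ (queryOracle x *ᵥ Ψ x)) = 1
        rw [nsq_mulVec_of_mem_unitaryGroup (A.unitaries j.succ).2,
          nsq_mulVec_of_mem_unitaryGroup (queryOracle_mem_unitaryGroup x), hunit x]
  rw [← hfin] at key
  obtain ⟨hW, hunit⟩ := key
  have hunit' : ∀ x, nsq (A.finalState x) = 1 := fun x => hunit x
  have h0 : prog R Ψ₀ = #R := by
    show prog R (fun _ => v) = _
    rw [prog_const, hv, mul_one]
  have hacc1 : ∀ x ∈ D, f x = true → 2 / 3 ≤ ∑ s with s ∈ A.accept, ‖A.finalState x s‖ ^ 2 := by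
    intro x hxD hx
    have h := (hA x hxD).1 hx
    rw [QQueryAlg.acceptProb] at h
    linarith
  have hacc0 : ∀ x ∈ D, f x = false → ∑ s with s ∈ A.accept, ‖A.finalState x s‖ ^ 2 ≤ 1 / 3 := by
    intro x hxD hx
    have h := (hA x hxD).2 hx
    rwa [QQueryAlg.acceptProb] at h
  have hT : prog R (fun x => A.finalState x) ≤ (1 - 1 / 72) * #R :=
    prog_final_le R hD hf _ _ hunit' hacc1 hacc0
  rw [h0] at hW
  linarith

/-- Fibre counting: if every left end has at least `m₀` partners then `m₀ |R.fst| ≤ |R|`. [cite: Ambainis2000, Thm. 6] -/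
theorem mul_card_image_fst_le (R : Rel N) {m₀ : ℝ}
    (hdeg : ∀ e ∈ R, m₀ ≤ #(R.filter fun e' => e'.1 = e.1)) :
    m₀ * #(R.image Prod.fst) ≤ #R := by
  classical
  rw [Finset.card_eq_sum_card_fiberwise (s := R) (t := R.image Prod.fst) (f := Prod.fst)
    (fun e he => Finset.mem_image_of_mem _ he)]
  push_cast
  rw [mul_comm, ← nsmul_eq_mul, ← Finset.sum_const]
  refine Finset.sum_le_sum fun x hx => ?_
  obtain ⟨e, he, rfl⟩ := Finset.mem_image.1 hx
  exact hdeg e he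

/-- The same for right ends. [cite: Ambainis2000, Thm. 6] -/
theorem mul_card_image_snd_le (R : Rel N) {m₁ : ℝ}
    (hdeg : ∀ e ∈ R, m₁ ≤ #(R.filter fun e' => e'.2 = e.2)) :
    m₁ * #(R.image Prod.snd) ≤ #R := by
  classical
  rw [Finset.card_eq_sum_card_fiberwise (s := R) (t := R.image Prod.snd) (f := Prod.snd)
    (fun e he => Finset.mem_image_of_mem _ he)]
  push_cast
  rw [mul_comm, ← nsmul_eq_mul, ← Finset.sum_const]
  refine Finset.sum_le_sum fun y hy => ?_
  obtain ⟨e, he, rfl⟩ := Finset.mem_image.1 hy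
  exact hdeg e he

/-- **Ambainis's Theorem 6** (weighted relational adversary) for `QQueryAlg`, promise version,
in the constant of the tree's gap lemma: `√(m₀ m₁ / ℓ) ≤ 144 · T`. [cite: Ambainis2000, Thm. 6] -/
theorem sqrt_le_queries (A : QQueryAlg N) {D : Set (Fin N → Bool)} {f : (Fin N → Bool) → Bool}
    (hA : A.ComputesWithError (1 / 3) D f) (R : Rel N) (hRne : R.Nonempty)
    (hD : ∀ e ∈ R, e.1 ∈ D ∧ e.2 ∈ D) (hf : ∀ e ∈ R, f e.1 ≠ f e.2)
    {m₀ m₁ ℓ : ℝ} (hm₀ : 0 < m₀) (hm₁ : 0 < m₁) (hℓ : 0 < ℓ)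
    (hdeg₀ : ∀ e ∈ R, m₀ ≤ #(R.filter fun e' => e'.1 = e.1))
    (hdeg₁ : ∀ e ∈ R, m₁ ≤ #(R.filter fun e' => e'.2 = e.2))
    (hR : ∀ e ∈ R, ∀ i, e.1 i ≠ e.2 i → (l1 R e.1 i : ℝ) * l2 R e.2 i ≤ ℓ) :
    Real.sqrt (m₀ * m₁ / ℓ) ≤ 144 * A.queries := by
  set lam : ℝ := Real.sqrt (m₀ / m₁) with hlam
  have hlampos : 0 < lam := Real.sqrt_pos.2 (div_pos hm₀ hm₁)
  have hmain := card_le_queries_mul A hA R hD hf hℓ hlampos hR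
  have hX := mul_card_image_fst_le R hdeg₀
  have hY := mul_card_image_snd_le R hdeg₁
  have hRpos : (0 : ℝ) < #R := by exact_mod_cast hRne.card_pos
  have hsℓ : 0 < Real.sqrt ℓ := Real.sqrt_pos.2 hℓ
  -- λ |X| + |Y|/λ ≤ |R| (λ/m₀ + 1/(λ m₁)) = 2 |R| / √(m₀ m₁)
  have hXle : (#(R.image Prod.fst) : ℝ) ≤ #R / m₀ := by
    rw [le_div_iff₀ hm₀, mul_comm]; exact hX
  have hYle : (#(R.image Prod.snd) : ℝ) ≤ #R / m₁ := by
    rw [le_div_iff₀ hm₁, mul_comm]; exact hY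
  have hsm : Real.sqrt (m₀ * m₁) * Real.sqrt (m₀ * m₁) = m₀ * m₁ :=
    Real.mul_self_sqrt (by positivity)
  have hsm_pos : 0 < Real.sqrt (m₀ * m₁) := Real.sqrt_pos.2 (by positivity)
  have hlam1 : lam / m₀ = 1 / Real.sqrt (m₀ * m₁) := by
    rw [hlam, div_eq_div_iff hm₀.ne' hsm_pos.ne', one_mul, ← Real.sqrt_mul (div_pos hm₀ hm₁).le]
    rw [show m₀ / m₁ * (m₀ * m₁) = m₀ ^ 2 by field_simp]
    exact Real.sqrt_sq hm₀.le
  have hlam2 : 1 / (lam * m₁) = 1 / Real.sqrt (m₀ * m₁) := by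
    rw [hlam, div_eq_div_iff (mul_pos hlampos hm₁).ne' hsm_pos.ne', one_mul, one_mul]
    rw [← Real.sqrt_sq hm₁.le, ← Real.sqrt_mul (div_pos hm₀ hm₁).le, Real.sqrt_sq hm₁.le]
    congr 1
    field_simp
  have hbound : lam * #(R.image Prod.fst) + #(R.image Prod.snd) / lam ≤ 2 * #R / Real.sqrt (m₀ * m₁) := by
    calc lam * #(R.image Prod.fst) + #(R.image Prod.snd) / lam
        ≤ lam * (#R / m₀) + (#R / m₁) / lam := by gcongr
      _ = #R * (lam / m₀) + #R * (1 / (lam * m₁)) := by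
          field_simp
      _ = 2 * #R / Real.sqrt (m₀ * m₁) := by rw [hlam1, hlam2]; ring
  have h2 : (#R : ℝ) / 72 ≤ A.queries * (Real.sqrt ℓ * (2 * #R / Real.sqrt (m₀ * m₁))) := by
    refine hmain.trans ?_
    gcongr
  -- divide by |R| > 0
  set K : ℝ := 2 * A.queries * Real.sqrt ℓ / Real.sqrt (m₀ * m₁) with hK
  have hK' : (A.queries : ℝ) * (Real.sqrt ℓ * (2 * #R / Real.sqrt (m₀ * m₁))) = K * #R := by
    rw [hK]; ring
  rw [hK'] at h2
  have h5 : (1 : ℝ) / 72 ≤ K := by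
    by_contra hlt
    push Not at hlt
    have : K * #R < (#R : ℝ) / 72 := by
      have := mul_lt_mul_of_pos_right hlt hRpos
      linarith
    linarith
  have h6 : Real.sqrt (m₀ * m₁) ≤ 144 * A.queries * Real.sqrt ℓ := by
    rw [hK, le_div_iff₀ hsm_pos] at h5
    linarith
  rw [Real.sqrt_div' _ hℓ.le, div_le_iff₀ hsℓ]
  linarith

/-- **Ambainis's Theorem 6 in terms of `Q_{1/3}`** (promise version). [cite: Ambainis2000, Thm. 6] -/
theorem sqrt_le_quantumQueryComplexityOn {D : Set (Fin N → Bool)} {f : (Fin N → Bool) → Bool}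
    (R : Rel N) (hRne : R.Nonempty)
    (hD : ∀ e ∈ R, e.1 ∈ D ∧ e.2 ∈ D) (hf : ∀ e ∈ R, f e.1 ≠ f e.2)
    {m₀ m₁ ℓ : ℝ} (hm₀ : 0 < m₀) (hm₁ : 0 < m₁) (hℓ : 0 < ℓ)
    (hdeg₀ : ∀ e ∈ R, m₀ ≤ #(R.filter fun e' => e'.1 = e.1))
    (hdeg₁ : ∀ e ∈ R, m₁ ≤ #(R.filter fun e' => e'.2 = e.2))
    (hR : ∀ e ∈ R, ∀ i, e.1 i ≠ e.2 i → (l1 R e.1 i : ℝ) * l2 R e.2 i ≤ ℓ) :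
    Real.sqrt (m₀ * m₁ / ℓ) ≤ 144 * (quantumQueryComplexityOn (1 / 3) D f : ℝ) := by
  rcases Nat.eq_zero_or_pos N with rfl | hN
  · obtain ⟨e, he⟩ := hRne
    exact absurd (congrArg f (Subsingleton.elim e.1 e.2)) (hf e he)
  haveI : NeZero N := NeZero.of_pos hN
  obtain ⟨A, hAq, hA⟩ := exists_queries_eq_quantumQueryComplexityOn (N := N)
    (ε := 1 / 3) (by norm_num) D f
  have h := sqrt_le_queries A hA R hRne hD hf hm₀ hm₁ hℓ hdeg₀ hdeg₁ hR
  rw [hAq] at h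
  exact h

/-- The `X / Y`-sided packaging (as stated in the crux work file `Disproof.lean`, §7,
`WeightedAdversaryBound`, with `κ = 1/144`). [cite: Ambainis2000, Thm. 6] -/
theorem weightedAdversaryBound_holds :
    ∃ κ : ℝ, 0 < κ ∧ ∀ (N : ℕ) (D : Set (Fin N → Bool)) (f : (Fin N → Bool) → Bool)
      (X Y : Finset (Fin N → Bool)) (R : Finset ((Fin N → Bool) × (Fin N → Bool)))
      (m₀ m₁ ℓ : ℝ), 0 < m₀ → 0 < m₁ → 0 < ℓ → R.Nonempty →
      (↑X ⊆ D) → (↑Y ⊆ D) → (∀ x ∈ X, f x = false) → (∀ y ∈ Y, f y = true) →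
      (∀ p ∈ R, p.1 ∈ X ∧ p.2 ∈ Y) →
      (∀ x ∈ X, m₀ ≤ ((R.filter fun p => p.1 = x).card : ℝ)) →
      (∀ y ∈ Y, m₁ ≤ ((R.filter fun p => p.2 = y).card : ℝ)) →
      (∀ p ∈ R, ∀ i : Fin N, p.1 i ≠ p.2 i →
        ((R.filter fun q => q.1 = p.1 ∧ q.2 i ≠ p.1 i).card : ℝ) *
          ((R.filter fun q => q.2 = p.2 ∧ q.1 i ≠ p.2 i).card : ℝ) ≤ ℓ) →
      κ * Real.sqrt (m₀ * m₁ / ℓ) ≤ (quantumQueryComplexityOn (1 / 3) D f : ℝ) := by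
  refine ⟨1 / 144, by norm_num, ?_⟩
  intro N D f X Y R m₀ m₁ ℓ hm₀ hm₁ hℓ hRne hX hY hfX hfY hXY hdeg₀ hdeg₁ hℓR
  have hD : ∀ e ∈ R, e.1 ∈ D ∧ e.2 ∈ D := fun e he =>
    ⟨hX (Finset.mem_coe.2 (hXY e he).1), hY (Finset.mem_coe.2 (hXY e he).2)⟩
  have hf : ∀ e ∈ R, f e.1 ≠ f e.2 := fun e he => by
    rw [hfX _ (hXY e he).1, hfY _ (hXY e he).2]; exact Bool.false_ne_true
  have hdeg₀' : ∀ e ∈ R, m₀ ≤ #(R.filter fun e' => e'.1 = e.1) := fun e he => hdeg₀ _ (hXY e he).1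
  have hdeg₁' : ∀ e ∈ R, m₁ ≤ #(R.filter fun e' => e'.2 = e.2) := fun e he => hdeg₁ _ (hXY e he).2
  have hR : ∀ e ∈ R, ∀ i, e.1 i ≠ e.2 i → (l1 R e.1 i : ℝ) * l2 R e.2 i ≤ ℓ := by
    intro e he i hi
    have h := hℓR e he i hi
    have e1 : (R.filter fun q => q.1 = e.1 ∧ q.2 i ≠ e.1 i) = R.filter fun q => q.1 = e.1 ∧ q.1 i ≠ q.2 i := by
      refine Finset.filter_congr fun q _ => ?_
      constructor
      · rintro ⟨h1, h2⟩; exact ⟨h1, by rw [h1]; exact fun h' => h2 h'.symm⟩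
      · rintro ⟨h1, h2⟩; exact ⟨h1, by rw [h1] at h2; exact fun h' => h2 h'.symm⟩
    have e2 : (R.filter fun q => q.2 = e.2 ∧ q.1 i ≠ e.2 i) = R.filter fun q => q.2 = e.2 ∧ q.1 i ≠ q.2 i := by
      refine Finset.filter_congr fun q _ => ?_
      constructor
      · rintro ⟨h1, h2⟩; exact ⟨h1, by rw [h1]; exact h2⟩
      · rintro ⟨h1, h2⟩; exact ⟨h1, by rw [h1] at h2; exact h2⟩
    unfold l1 l2
    rw [← e1, ← e2]
    exact h
  have := sqrt_le_quantumQueryComplexityOn R hRne hD hf hm₀ hm₁ hℓ hdeg₀' hdeg₁' hR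
  linarith

end Summit.QuantumAdvantage.QuantumAdvantage.Theorems.WbwVerifiableLineNoSpeedup.Negative.WeightedAdversary
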